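import Mathlib
import Summits.SmoothPoincare4.SmoothPoincare4.Theorems.SoloInformedNashStipsiczGroup

/-!
# Solvable invariants of derived length three separate the Nash–Stipsicz group from `ℤ³ ⋊ ℤ`

Solo artefact (unit `solo-SmoothPoincare4-informed`), companion to `SoloInformedNashStipsiczGroup`
(`G_NS = ⟨x, y | x y x y x⁻¹ y⁻¹ x y⁻¹ x⁻¹ y⁻¹⟩`, the Nash–Stipsicz 2-knot group of `K²_{1,−1}`,
arXiv:1103.5571 Prop. 4.2, is not solvable) and to the metabelianisation files
(`G_NS ⧸ G_NS'' ≃* ℤ³ ⋊_{A₀} ℤ`, the Cappell–Shaneson/Akbulut–Kirby 2-knot group, so that every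
homomorphism from `G_NS` to a *metabelian* group factors through `ℤ³ ⋊_{A₀} ℤ`).

Here we show that *solvable* targets already see the difference, at derived length three:

* `NashStipsicz.AGammaL` : the group `AΓL(1, 8) = 𝔽₈ ⋊ (𝔽₈ˣ ⋊ Gal(𝔽₈/𝔽₂))` of order `168`, built
  as an iterated Mathlib `SemidirectProduct` `𝔽₂³ ⋊ (ℤ/7 ⋊ ℤ/3)` (`α³ = α + 1`; `ℤ/7` acts by
  multiplication by `α^u`, `ℤ/3` by the Frobenius), hence solvable (`isSolvable_AGammaL`);
* `NashStipsicz.solvRep : G_NS →* AΓL(1, 8)`, `x ↦ (0, (0, 2))`, `y ↦ (e₀, (3, 2))` (onto, by an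
  enumeration outside Lean: the images generate all `168` elements; `G_NS` has `1176`
  homomorphisms to `AΓL(1,8)` against `672` for `ℤ³ ⋊_{A₀} ℤ`);
* `NashStipsicz.not_derivedSeries_two_le_ker_solvRep` : `solvRep` does **not** kill
  `G_NS''` — the element `⁅⁅x, y⁆, ⁅x, y⁻¹⁆⁆ ∈ G_NS''` maps to the translation `e₀ ≠ 0`;
* `NashStipsicz.exists_solvable_not_killing_derivedSeries_two` : hence there is a finite solvable
  group `S` and `f : G_NS →* S` with `G_NS'' ⊄ ker f`, whereas
  `NashStipsicz.derivedSeries_two_semidirectProduct_eq_bot` : for abelian `N`, `C` and any action,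
  `(N ⋊ C)'' = 1`, so every homomorphism out of any `ℤ³ ⋊_φ ℤ` kills the second derived subgroup.

Reading: the Hom-count invariant `|Hom(·, AΓL(1,8))|` distinguishes the Nash–Stipsicz 2-knot group
from the Cappell–Shaneson one although both have Alexander module `Λ/(1 − t + 2t² − t³)` and the
same maximal metabelian quotient; `AΓL(1,8)'' = 𝔽₈` receives `G_NS''` non-trivially.
-/

namespace Summit.SmoothPoincare4.SmoothPoincare4.Theorems

namespace NashStipsicz

open Multiplicative
open scoped commutatorElement

/-! ### Generalities on semidirect products -/

/-- A semidirect product of two abelian groups is metabelian: `(N ⋊ C)'' = 1`.  In particular every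
`ℤ³ ⋊_φ ℤ` (the Cappell–Shaneson 2-knot groups) has trivial second derived subgroup. -/
theorem derivedSeries_two_semidirectProduct_eq_bot {N C : Type*} [CommGroup N] [CommGroup C]
    (φ : C →* MulAut N) : derivedSeries (N ⋊[φ] C) 2 = ⊥ := by
  have h1 : derivedSeries (N ⋊[φ] C) 1 ≤ (SemidirectProduct.inl (φ := φ)).range := by
    rw [derivedSeries_one, SemidirectProduct.range_inl_eq_ker_rightHom]
    exact Abelianization.commutator_subset_ker _
  have h2 : derivedSeries (N ⋊[φ] C) 2 =
      ⁅derivedSeries (N ⋊[φ] C) 1, derivedSeries (N ⋊[φ] C) 1⁆ := derivedSeries_succ _ 1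
  rw [h2, eq_bot_iff]
  calc ⁅derivedSeries (N ⋊[φ] C) 1, derivedSeries (N ⋊[φ] C) 1⁆
      ≤ ⁅(SemidirectProduct.inl (φ := φ)).range, (SemidirectProduct.inl (φ := φ)).range⁆ :=
        Subgroup.commutator_mono h1 h1
    _ = ⊥ := by
        rw [Subgroup.commutator_eq_bot_iff_le_centralizer]
        rintro _ ⟨x, rfl⟩
        rw [Subgroup.mem_centralizer_iff]
        rintro _ ⟨y, rfl⟩
        rw [← map_mul, ← map_mul, mul_comm]
    _ ≤ ⊥ := le_rfl

/-! ### The Frobenius group `F₂₁ = ℤ/7 ⋊ ℤ/3` -/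

/-- Multiplication by `2^k` on `ℤ/7` (`k ∈ ℤ/3`; `2³ = 1 (mod 7)`), as an automorphism. -/
def frobAut (k : Multiplicative (ZMod 3)) : MulAut (Multiplicative (ZMod 7)) where
  toFun u := ofAdd ((2 : ZMod 7) ^ (toAdd k).val * toAdd u)
  invFun u := ofAdd ((4 : ZMod 7) ^ (toAdd k).val * toAdd u)
  left_inv := by intro u; revert k u; decide
  right_inv := by intro u; revert k u; decide
  map_mul' := by intro u v; revert k u v; decide

/-- The action `k ↦ (u ↦ 2^k u)` of `ℤ/3` on `ℤ/7`. -/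
def frobAct : Multiplicative (ZMod 3) →* MulAut (Multiplicative (ZMod 7)) where
  toFun := frobAut
  map_one' := by
    refine MulEquiv.ext fun u => ?_
    revert u; decide
  map_mul' := by
    intro k l
    refine MulEquiv.ext fun u => ?_
    revert k l u; decide

/-- The Frobenius group `F₂₁ = ℤ/7 ⋊ ℤ/3` (`≅ 𝔽₈ˣ ⋊ Gal(𝔽₈/𝔽₂)`). -/
abbrev F21 : Type := Multiplicative (ZMod 7) ⋊[frobAct] Multiplicative (ZMod 3)

/-- `F₂₁` is finite (of order `21`). -/
instance instFintypeF21 : Fintype F21 := Fintype.ofEquiv _ SemidirectProduct.equivProd.symm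

/-- `F₂₁` is solvable. -/
instance isSolvable_F21 : IsSolvable F21 := isSolvable_semidirectProduct _

/-! ### `AΓL(1,8) = 𝔽₂³ ⋊ F₂₁` -/

/-- `𝔽₈ = 𝔽₂³` as a multiplicative group (coordinates in the basis `1, α, α²`, `α³ = α + 1`). -/
abbrev V8 : Type := Multiplicative (Fin 3 → ZMod 2)

/-- Multiplication by `α` on `𝔽₂[α]/(α³ + α + 1)`: `(a, b, c) ↦ (c, a + c, b)`. -/
def mulAlpha (v : Fin 3 → ZMod 2) : Fin 3 → ZMod 2 := ![v 2, v 0 + v 2, v 1]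

/-- The Frobenius `x ↦ x²` of `𝔽₈`: `(a, b, c) ↦ (a, c, b + c)`. -/
def frobTwo (v : Fin 3 → ZMod 2) : Fin 3 → ZMod 2 := ![v 0, v 2, v 1 + v 2]

/-- `u ↦` multiplication by `α^u` (`u ∈ ℤ/7`), as an automorphism of `𝔽₂³`. -/
def alphaAut (u : Multiplicative (ZMod 7)) : MulAut V8 where
  toFun v := ofAdd (mulAlpha^[(toAdd u).val] (toAdd v))
  invFun v := ofAdd (mulAlpha^[7 - (toAdd u).val] (toAdd v))
  left_inv := by intro v; revert u v; decide
  right_inv := by intro v; revert u v; decide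
  map_mul' := by intro v w; revert u v w; decide

/-- The action of `ℤ/7 = 𝔽₈ˣ` on `𝔽₂³` by powers of `α`. -/
def alphaAct : Multiplicative (ZMod 7) →* MulAut V8 where
  toFun := alphaAut
  map_one' := by
    refine MulEquiv.ext fun v => ?_
    revert v; decide
  map_mul' := by
    intro a b
    refine MulEquiv.ext fun v => ?_
    revert a b v; decide

/-- `c ↦ Frobenius^c` (`c ∈ ℤ/3`), as an automorphism of `𝔽₂³`. -/
def frobVAut (c : Multiplicative (ZMod 3)) : MulAut V8 where
  toFun v := ofAdd (frobTwo^[(toAdd c).val] (toAdd v))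
  invFun v := ofAdd (frobTwo^[3 - (toAdd c).val] (toAdd v))
  left_inv := by intro v; revert c v; decide
  right_inv := by intro v; revert c v; decide
  map_mul' := by intro v w; revert c v w; decide

/-- The action of `ℤ/3 = Gal(𝔽₈/𝔽₂)` on `𝔽₂³`. -/
def frobVAct : Multiplicative (ZMod 3) →* MulAut V8 where
  toFun := frobVAut
  map_one' := by
    refine MulEquiv.ext fun v => ?_
    revert v; decide
  map_mul' := by
    intro a b
    refine MulEquiv.ext fun v => ?_
    revert a b v; decide

/-- The action of `F₂₁` on `𝔽₈`: `(u, c) ↦ (x ↦ α^u · x^{2^c})` (the two actions are compatible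
because `Frob ∘ (α·) = (α²·) ∘ Frob`). -/
def f21Act : F21 →* MulAut V8 :=
  SemidirectProduct.lift alphaAct frobVAct (by
    intro c
    refine MonoidHom.ext fun u => MulEquiv.ext fun v => ?_
    revert c u v; decide)

/-- `AΓL(1, 8) = 𝔽₈ ⋊ (𝔽₈ˣ ⋊ Gal(𝔽₈/𝔽₂))`, as the iterated semidirect product `𝔽₂³ ⋊ F₂₁`. -/
abbrev AGammaL : Type := V8 ⋊[f21Act] F21

/-- `AΓL(1, 8)` is finite. -/
instance instFintypeAGammaL : Fintype AGammaL :=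
  Fintype.ofEquiv _ SemidirectProduct.equivProd.symm

/-- `|AΓL(1, 8)| = 168`. -/
theorem card_AGammaL : Fintype.card AGammaL = 168 := by
  simp only [Fintype.ofEquiv_card, Fintype.card_prod, Fintype.card_fun, ZMod.card, Fintype.card_fin]
  rfl

/-- `AΓL(1, 8)` is solvable (abelian-by-abelian-by-abelian). -/
theorem isSolvable_AGammaL : IsSolvable AGammaL := isSolvable_semidirectProduct _

/-! ### The homomorphism `G_NS → AΓL(1,8)` -/

/-- `x ↦ ā = (0, (0, 2))`: the square of the Frobenius. -/
def aS : AGammaL := ⟨1, ⟨1, ofAdd 2⟩⟩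

/-- `y ↦ b̄ = (e₀, (3, 2))`. -/
def bS : AGammaL := ⟨ofAdd ![1, 0, 0], ⟨ofAdd 3, ofAdd 2⟩⟩

/-- The relator evaluated on `(ā, b̄)`. -/
def sR : AGammaL := aS * bS * aS * bS * aS⁻¹ * bS⁻¹ * aS * bS⁻¹ * aS⁻¹ * bS⁻¹

/-- `r(ā, b̄) = 1` in `AΓL(1, 8)`. -/
theorem sR_eq_one : sR = 1 :=
  SemidirectProduct.ext (by decide) (SemidirectProduct.ext (by decide) (by decide))

/-- The generator assignment `x ↦ ā`, `y ↦ b̄`. -/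
def sGen : Fin 2 → AGammaL := fun i => if i = 0 then aS else bS

/-- `FreeGroup.lift sGen` evaluates the relator to `sR`. -/
theorem lift_sGen_nsRelator : FreeGroup.lift sGen nsRelator = sR := by
  simp [nsRelator, sR, sGen, map_mul, map_inv]

/-- The representation `G_NS → AΓL(1, 8)`, `x ↦ ā`, `y ↦ b̄`. -/
def solvRep : NSGroup →* AGammaL :=
  PresentedGroup.toGroup (f := sGen) (by
    intro r hr
    rw [Set.mem_singleton_iff] at hr
    subst hr
    rw [lift_sGen_nsRelator, sR_eq_one])

/-- `solvRep x = ā`. -/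
theorem solvRep_of_zero : solvRep (PresentedGroup.of (0 : Fin 2)) = aS := by
  simp [solvRep, sGen]

/-- `solvRep y = b̄`. -/
theorem solvRep_of_one : solvRep (PresentedGroup.of (1 : Fin 2)) = bS := by
  simp [solvRep, sGen]

/-- The generator `x` of `G_NS`. -/
abbrev xNS : NSGroup := PresentedGroup.of (0 : Fin 2)

/-- The generator `y` of `G_NS`. -/
abbrev yNS : NSGroup := PresentedGroup.of (1 : Fin 2)

/-- The test element `g = ⁅⁅x, y⁆, ⁅x, y⁻¹⁆⁆` of `G_NS''`. -/
def gNS : NSGroup := ⁅⁅xNS, yNS⁆, ⁅xNS, yNS⁻¹⁆⁆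

/-- `g ∈ G_NS''`. -/
theorem gNS_mem : gNS ∈ derivedSeries NSGroup 2 := by
  rw [derivedSeries_succ, derivedSeries_one, commutator_def]
  exact Subgroup.commutator_mem_commutator
    (Subgroup.commutator_mem_commutator (Subgroup.mem_top _) (Subgroup.mem_top _))
    (Subgroup.commutator_mem_commutator (Subgroup.mem_top _) (Subgroup.mem_top _))

/-- `solvRep g = ⁅⁅ā, b̄⁆, ⁅ā, b̄⁻¹⁆⁆`. -/
theorem solvRep_gNS : solvRep gNS = ⁅⁅aS, bS⁆, ⁅aS, bS⁻¹⁆⁆ := by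
  simp only [gNS, xNS, yNS, map_commutatorElement, map_inv, solvRep_of_zero, solvRep_of_one]

/-- `solvRep g ≠ 1`: it is the translation by `e₀`. -/
theorem solvRep_gNS_ne_one : solvRep gNS ≠ 1 := by
  rw [solvRep_gNS]
  intro h
  exact absurd (congrArg SemidirectProduct.left h) (by decide)

/-- **`solvRep` does not kill `G_NS''`.** -/
theorem not_derivedSeries_two_le_ker_solvRep : ¬ derivedSeries NSGroup 2 ≤ solvRep.ker :=
  fun h => solvRep_gNS_ne_one (h gNS_mem)

/-- **Solvable invariants see what metabelian ones cannot.** There is a finite solvable group `S`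
and a homomorphism `f : G_NS → S` that does not factor through the metabelianisation
`G_NS ⧸ G_NS'' (≅ ℤ³ ⋊_{A₀} ℤ)`; by `derivedSeries_two_semidirectProduct_eq_bot` no such `f` exists
out of any `ℤ³ ⋊_φ ℤ`. -/
theorem exists_solvable_not_killing_derivedSeries_two :
    ∃ (S : Type) (_ : Group S) (_ : Fintype S), IsSolvable S ∧
      ∃ f : NSGroup →* S, ¬ derivedSeries NSGroup 2 ≤ f.ker :=
  ⟨AGammaL, inferInstance, inferInstance, isSolvable_AGammaL, solvRep,
    not_derivedSeries_two_le_ker_solvRep⟩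

end NashStipsicz

end Summit.SmoothPoincare4.SmoothPoincare4.Theorems
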